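import Mathlib
import Summits.NavierStokesRegularity.NavierStokesRegularity.Theorems.SubOnsagerCeilingSideBranchThresholdStep
import Summits.NavierStokesRegularity.NavierStokesRegularity.Theorems.SubOnsagerCeilingSideBranchSideRelax
import Summits.NavierStokesRegularity.NavierStokesRegularity.Theorems.SubOnsagerCeilingSideBranchDatumDecay
import Literature.NumberTheory.LFunctions.PrimeReciprocalWindows
import HarnessLib

/-!
# Route SubOnsagerCeiling — the DATUM SHELL of `α_SB` RELAXES (first conjunct of the per-shell retention target)
# (helper file for item stmt-NavierStokesRegularity-25507 `OrthantTailCeiling`; `--supports`; def-free)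

Assembly of three bricks into the first conjunct of `SideBranchShellRetentionAt` (p825614; the target to
which the refutation of the aside cruxes `OrthantTailCeiling` / `ForwardTailCeiling` is reduced by
p825506 / p824789 / p824871): along a regular `ν`-viscous solution of `α_SB` that is non-negative on the
shells `≥ 0`, with the pocket `z₁` capped by `M` (e.g. `√(2E₀)`) and no pocket/idle energy on the datum
shell, the datum-shell energy is eventually as small as we please, at an EXPLICIT time uniform in small `ν`:

* (calculus `x/2 ≤ 1 − e^{−x}` for `0 ≤ x ≤ 1` is the tree's `PrimeReciprocal.half_le_one_sub_exp_neg`);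
* `sideBranch_datum_chain_antitone` — `x₀` is non-increasing on `[0,s]` (only drained);
* `sideBranch_datum_shell_relax` — for `r, σ > 0` put `r₁ = Λ₀M/5 + ν₀`, `T_x = 1/r₁ + 25r₁x₀(0)/(Λ₀²r³) + 1`,
  `Δ = 10M/(Λ₀σ²) + 1`; if `T_x + Δ ≤ T ≤ s` and `ν₁Δ ≤ 1` then **`Σ_i ½X_{i,0}(T)² ≤ ½r² + ½σ²`**.
  Proof: `x₀(T_x) < r` (`sideBranch_datum_chain_decay`, p825888) and `x₀` stays below `r`; on
  `[T_x, T_x+Δ]` the side mode cannot stay above `σ` (`sideBranch_pocket_drive`, p825420: the pocket would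
  exceed its cap `M`), so at some `T₁` there both `x₀ ≤ r` and `s₀ ≤ σ`; the shell energy is non-increasing
  (`sideBranch_block_antitone`), hence `≤ ½r² + ½σ²` from `T₁` on.

HONEST FRAMING: elementary real analysis of a Tao-type MODEL lattice ODE (route SubOnsagerCeiling, rung
TL-M2Break); one conjunct of an unproved construction target; nothing bears on Navier–Stokes regularity; no
crux is settled here. [cite: Tao2016AveragedNS, §4 (4.2)–(4.3)]; Katz–Pavlović couplings:
[cite: BarbatoMorandinRomito2011, §2].
-/

noncomputable section

-- the sub-problem namespace `NavierStokesRegularity.NavierStokesRegularity` is the tree's layout (D-0017)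
set_option linter.dupNamespace false

namespace Summit.NavierStokesRegularity.NavierStokesRegularity.Theorems.SubOnsagerCeiling

open Set
open Literature.Analysis.FluidPDE.TaoCascade

section Solution

variable {ε₀ ν s : ℝ} {X : Fin 4 → ℤ → ℝ → ℝ}

/-- **The datum chain mode is non-increasing** (`ẋ₀ = −Λ₀x₀(x₁ + s₀/5) − ν₀x₀ ≤ 0` when
`x₀, x₁, s₀ ≥ 0`, no shell `−1`). [this file] -/
theorem sideBranch_datum_chain_antitone (hε : 0 < ε₀) (hν : 0 ≤ ν)
    (hlow : ∀ (i : Fin 4) (k : ℤ), k < 0 → ∀ t : ℝ, X i k t = 0)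
    (hder : ∀ (i : Fin 4) (k : ℤ), ∀ t ∈ Icc (0 : ℝ) s, HasDerivWithinAt (X i k)
      (quadTerm ε₀ sideBranchTable X i k t - ν * (1 + ε₀) ^ ((2 : ℝ) * k) * X i k t)
      (Icc (0 : ℝ) s) t)
    (hpos : ∀ t ∈ Icc (0 : ℝ) s, ∀ (i : Fin 4) (k : ℤ), 0 ≤ k → 0 ≤ X i k t)
    {u₁ u₂ : ℝ} (hu₁ : 0 ≤ u₁) (hu : u₁ ≤ u₂) (hu₂ : u₂ ≤ s) : X 0 0 u₂ ≤ X 0 0 u₁ := by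
  have hb : (0 : ℝ) < 1 + ε₀ := by linarith
  set Λ : ℝ := (1 + ε₀) ^ ((5 : ℝ) * ((0 : ℤ) : ℝ) / 2) with hΛ
  set c₀ : ℝ := ν * (1 + ε₀) ^ ((2 : ℝ) * ((0 : ℤ) : ℝ)) with hc₀
  have hΛ0 : 0 < Λ := Real.rpow_pos_of_pos hb _
  have hc₀0 : 0 ≤ c₀ := mul_nonneg hν (Real.rpow_nonneg hb.le _)
  have hsub : Icc u₁ u₂ ⊆ Icc (0 : ℝ) s := Icc_subset_Icc hu₁ hu₂
  have hderΨ : ∀ w ∈ Icc u₁ u₂, HasDerivWithinAt (fun w => -X 0 0 w)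
      (-(quadTerm ε₀ sideBranchTable X 0 0 w - c₀ * X 0 0 w)) (Icc u₁ u₂) w :=
    fun w hw => ((hder 0 0 w (hsub hw)).mono hsub).neg
  have hposΨ : ∀ w ∈ Icc u₁ u₂, 0 ≤ -(quadTerm ε₀ sideBranchTable X 0 0 w - c₀ * X 0 0 w) := by
    intro w hw
    have hw' := hsub hw
    have hq0 : quadTerm ε₀ sideBranchTable X 0 0 w - c₀ * X 0 0 w =
        -(Λ * (X 0 0 w * X 0 (0 + 1) w) + (1 / 5 : ℝ) * Λ * (X 0 0 w * X 1 0 w) + c₀ * X 0 0 w) := by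
      rw [sideBranch_quadTerm_zero, ← hΛ]
      have h1 : X 0 (0 - 1) w = 0 := hlow 0 (0 - 1) (by norm_num) w
      rw [h1]; ring
    rw [hq0, neg_neg]
    have h1 := hpos w hw' 0 0 le_rfl
    have h2 := hpos w hw' 0 (0 + 1) (by norm_num)
    have h3 := hpos w hw' 1 0 le_rfl
    positivity
  have h := sideBranch_le_of_deriv_nonneg hderΨ hposΨ (right_mem_Icc.2 hu)
  linarith

/-- **The datum shell relaxes.** Along a regular solution of the `ν`-viscous `α_SB` lattice on `[0,s]`
(`0 < ν`, no shells below `0`) that is non-negative on the shells `≥ 0`, with `z₁ ≤ M` (`M > 0`) and no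
pocket / idle energy on the datum shell (`X_{2,0} = X_{3,0} = 0`) and `x₀(0) ≥ 0`, let `r, σ > 0`,
`r₁ = Λ₀M/5 + ν₀`, `T_x = 1/r₁ + 25r₁x₀(0)/(Λ₀²r³) + 1`, `Δ = 10M/(Λ₀σ²) + 1`. If `ν₁Δ ≤ 1` and
`T_x + Δ ≤ T ≤ s`, then `Σ_i ½X_{i,0}(T)² ≤ ½r² + ½σ²`. [this file] -/
theorem sideBranch_datum_shell_relax (hε : 0 < ε₀) (hν : 0 < ν)
    (hlow : ∀ (i : Fin 4) (k : ℤ), k < 0 → ∀ t : ℝ, X i k t = 0)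
    (hder : ∀ (i : Fin 4) (k : ℤ), ∀ t ∈ Icc (0 : ℝ) s, HasDerivWithinAt (X i k)
      (quadTerm ε₀ sideBranchTable X i k t - ν * (1 + ε₀) ^ ((2 : ℝ) * k) * X i k t)
      (Icc (0 : ℝ) s) t)
    (hpos : ∀ t ∈ Icc (0 : ℝ) s, ∀ (i : Fin 4) (k : ℤ), 0 ≤ k → 0 ≤ X i k t)
    (hz00 : ∀ t ∈ Icc (0 : ℝ) s, X 2 0 t = 0) (hw00 : ∀ t ∈ Icc (0 : ℝ) s, X 3 0 t = 0)
    {M r σ T : ℝ} (hM : 0 < M) (hzM : ∀ t ∈ Icc (0 : ℝ) s, X 2 1 t ≤ M) (hr : 0 < r) (hσ : 0 < σ)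
    (hx00 : 0 ≤ X 0 0 0)
    (hνΔ : ν * (1 + ε₀) ^ ((2 : ℝ) * ((0 + 1 : ℤ) : ℝ)) *
      (10 * M / ((1 + ε₀) ^ ((5 : ℝ) * ((0 : ℤ) : ℝ) / 2) * σ ^ 2) + 1) ≤ 1)
    (hT : 1 / ((1 / 5 : ℝ) * (1 + ε₀) ^ ((5 : ℝ) * ((0 : ℤ) : ℝ) / 2) * M +
            ν * (1 + ε₀) ^ ((2 : ℝ) * ((0 : ℤ) : ℝ))) +
          25 * ((1 / 5 : ℝ) * (1 + ε₀) ^ ((5 : ℝ) * ((0 : ℤ) : ℝ) / 2) * M +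
            ν * (1 + ε₀) ^ ((2 : ℝ) * ((0 : ℤ) : ℝ))) * X 0 0 0 /
            (((1 + ε₀) ^ ((5 : ℝ) * ((0 : ℤ) : ℝ) / 2)) ^ 2 * r ^ 3) + 1 +
          (10 * M / ((1 + ε₀) ^ ((5 : ℝ) * ((0 : ℤ) : ℝ) / 2) * σ ^ 2) + 1) ≤ T)
    (hTs : T ≤ s) :
    (∑ i : Fin 4, (1 / 2 : ℝ) * X i 0 T ^ 2) ≤ (1 / 2 : ℝ) * r ^ 2 + (1 / 2 : ℝ) * σ ^ 2 := by
  have hb : (0 : ℝ) < 1 + ε₀ := by linarith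
  set Λ : ℝ := (1 + ε₀) ^ ((5 : ℝ) * ((0 : ℤ) : ℝ) / 2) with hΛ
  set c₀ : ℝ := ν * (1 + ε₀) ^ ((2 : ℝ) * ((0 : ℤ) : ℝ)) with hc₀
  set c₁ : ℝ := ν * (1 + ε₀) ^ ((2 : ℝ) * ((0 + 1 : ℤ) : ℝ)) with hc₁
  have hΛ0 : 0 < Λ := Real.rpow_pos_of_pos hb _
  have hc₀0 : 0 ≤ c₀ := (mul_pos hν (Real.rpow_pos_of_pos hb _)).le
  have hc₁0 : 0 < c₁ := mul_pos hν (Real.rpow_pos_of_pos hb _)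
  set r₁ : ℝ := (1 / 5 : ℝ) * Λ * M + c₀ with hr₁def
  have hr₁ : 0 < r₁ := by
    have : 0 < (1 / 5 : ℝ) * Λ * M := by positivity
    rw [hr₁def]; linarith
  set Tx : ℝ := 1 / r₁ + 25 * r₁ * X 0 0 0 / (Λ ^ 2 * r ^ 3) + 1 with hTxdef
  set Δ : ℝ := 10 * M / (Λ * σ ^ 2) + 1 with hΔdef
  have hTx0 : 0 < Tx := by
    have h1 : 0 < 1 / r₁ := by positivity
    have h2 : 0 ≤ 25 * r₁ * X 0 0 0 / (Λ ^ 2 * r ^ 3) := by positivity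
    rw [hTxdef]; linarith
  have hΔ0 : 0 < Δ := by
    have h1 : 0 ≤ 10 * M / (Λ * σ ^ 2) := by positivity
    rw [hΔdef]; linarith
  have hTxT : Tx + Δ ≤ T := hT
  have hTxs : Tx ≤ s := by linarith
  have hTxΔs : Tx + Δ ≤ s := by linarith
  -- Step 1: `x₀(T_x) < r`
  have hxTx : X 0 0 Tx < r := by
    by_contra hcon
    rw [not_lt] at hcon
    have hsubx : Icc (0 : ℝ) Tx ⊆ Icc (0 : ℝ) s := Icc_subset_Icc le_rfl hTxs
    have h := sideBranch_datum_chain_decay hε hν.le hlow hder hTx0 hTxs hM hr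
      (fun u hu => hpos u (hsubx hu) 0 0 le_rfl) (fun u hu => hpos u (hsubx hu) 0 1 (by norm_num))
      (fun u hu => hpos u (hsubx hu) 1 0 le_rfl) (fun u hu => hzM u (hsubx hu)) hcon
    rw [← hΛ, ← hc₀, ← hr₁def] at h
    have hxTx0 : 0 ≤ X 0 0 Tx := hpos Tx ⟨hTx0.le, hTxs⟩ 0 0 le_rfl
    have hwin : Tx - 1 / r₁ = 25 * r₁ * X 0 0 0 / (Λ ^ 2 * r ^ 3) + 1 := by rw [hTxdef]; ring
    rw [hwin] at h
    have hid : Λ ^ 2 * r ^ 3 / (25 * r₁) * (25 * r₁ * X 0 0 0 / (Λ ^ 2 * r ^ 3) + 1) =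
        X 0 0 0 + Λ ^ 2 * r ^ 3 / (25 * r₁) := by field_simp
    rw [hid] at h
    have hp : 0 < Λ ^ 2 * r ^ 3 / (25 * r₁) := by positivity
    linarith
  -- Step 2: on `[T_x, T_x + Δ]` the side mode dips to `≤ σ` at some `T₁`
  have hT₁ : ∃ T₁ ∈ Icc Tx (Tx + Δ), X 1 0 T₁ ≤ σ := by
    by_contra hcon
    push Not at hcon
    have hsk : ∀ u ∈ Icc Tx (Tx + Δ), 5 * ((1 / 5 : ℝ) * Λ * σ ^ 2) ≤
        (1 + ε₀) ^ ((5 : ℝ) * ((0 : ℤ) : ℝ) / 2) * X 1 0 u ^ 2 := by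
      intro u hu
      rw [← hΛ]
      have h1 : σ ^ 2 ≤ X 1 0 u ^ 2 := pow_le_pow_left₀ hσ.le (hcon u hu).le 2
      have h2 : Λ * σ ^ 2 ≤ Λ * X 1 0 u ^ 2 := mul_le_mul_of_nonneg_left h1 hΛ0.le
      linarith
    have hzpos : ∀ u ∈ Icc Tx (Tx + Δ), 0 ≤ X 2 (0 + 1) u :=
      fun u hu => hpos u ⟨hTx0.le.trans hu.1, hu.2.trans hTxΔs⟩ 2 (0 + 1) (by norm_num)
    have hdr := sideBranch_pocket_drive hε hν hder 0 hTx0.le hTxΔs hsk hzpos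
      (right_mem_Icc.2 (by linarith))
    rw [← hc₁] at hdr
    have hwin : Tx + Δ - Tx = Δ := by ring
    rw [hwin] at hdr
    -- `(p/ν₁)(1 − e^{−ν₁Δ}) ≥ pΔ/2 = M + Λσ²/10 > M`
    have hx1 : c₁ * Δ ≤ 1 := by rw [hc₁, hΔdef, hΛ]; exact hνΔ
    have hhalf := Literature.NumberTheory.LFunctions.PrimeReciprocal.half_le_one_sub_exp_neg
      (by positivity : 0 ≤ c₁ * Δ) hx1
    have hzcap : X 2 (0 + 1) (Tx + Δ) ≤ M := by
      have := hzM (Tx + Δ) ⟨by linarith, hTxΔs⟩; simpa using this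
    have hp0 : 0 ≤ (1 / 5 : ℝ) * Λ * σ ^ 2 / c₁ := by positivity
    have h1 : (1 / 5 : ℝ) * Λ * σ ^ 2 / c₁ * (c₁ * Δ / 2) ≤
        (1 / 5 : ℝ) * Λ * σ ^ 2 / c₁ * (1 - Real.exp (-(c₁ * Δ))) :=
      mul_le_mul_of_nonneg_left hhalf hp0
    have h2 : (1 / 5 : ℝ) * Λ * σ ^ 2 / c₁ * (c₁ * Δ / 2) = M + Λ * σ ^ 2 / 10 := by
      rw [hΔdef]; field_simp; ring
    have h3 : 0 < Λ * σ ^ 2 / 10 := by positivity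
    have h4 : M + Λ * σ ^ 2 / 10 ≤ M :=
      calc M + Λ * σ ^ 2 / 10 = (1 / 5 : ℝ) * Λ * σ ^ 2 / c₁ * (c₁ * Δ / 2) := h2.symm
        _ ≤ (1 / 5 : ℝ) * Λ * σ ^ 2 / c₁ * (1 - Real.exp (-(c₁ * Δ))) := h1
        _ ≤ X 2 (0 + 1) (Tx + Δ) := hdr
        _ ≤ M := hzcap
    linarith
  obtain ⟨T₁, hT₁mem, hsT₁⟩ := hT₁
  have hT₁0 : 0 ≤ T₁ := hTx0.le.trans hT₁mem.1
  have hT₁T : T₁ ≤ T := hT₁mem.2.trans hTxT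
  have hT₁s : T₁ ≤ s := hT₁T.trans hTs
  -- Step 3: at `T₁`, `x₀ ≤ x₀(T_x) < r` and `s₀ ≤ σ`; the shell energy is non-increasing afterwards
  have hxT₁ : X 0 0 T₁ ≤ r :=
    ((sideBranch_datum_chain_antitone hε hν.le hlow hder hpos hTx0.le hT₁mem.1 hT₁s).trans hxTx.le)
  have hxT₁0 : 0 ≤ X 0 0 T₁ := hpos T₁ ⟨hT₁0, hT₁s⟩ 0 0 le_rfl
  have hsT₁0 : 0 ≤ X 1 0 T₁ := hpos T₁ ⟨hT₁0, hT₁s⟩ 1 0 le_rfl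
  have hanti := sideBranch_block_antitone hε hν.le hlow hder hpos 0 hT₁0 hT₁T hTs
  simp only [zero_add, Finset.sum_range_one] at hanti
  have hshell : (∑ i : Fin 4, (1 / 2 : ℝ) * X i 0 T₁ ^ 2) ≤ (1 / 2 : ℝ) * r ^ 2 + (1 / 2 : ℝ) * σ ^ 2 := by
    rw [Fin.sum_univ_four, hz00 T₁ ⟨hT₁0, hT₁s⟩, hw00 T₁ ⟨hT₁0, hT₁s⟩]
    have h1 : X 0 0 T₁ ^ 2 ≤ r ^ 2 := pow_le_pow_left₀ hxT₁0 hxT₁ 2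
    have h2 : X 1 0 T₁ ^ 2 ≤ σ ^ 2 := pow_le_pow_left₀ hsT₁0 hsT₁ 2
    nlinarith
  have hcast : (∑ i : Fin 4, (1 / 2 : ℝ) * X i ((0 : ℕ) : ℤ) T ^ 2) =
      ∑ i : Fin 4, (1 / 2 : ℝ) * X i 0 T ^ 2 := by simp
  linarith [hanti, hshell]

end Solution

end Summit.NavierStokesRegularity.NavierStokesRegularity.Theorems.SubOnsagerCeiling

end
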